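import Summits.AtomisticToContinuum.HydrodynamicLimit.Theorems.InformationPercolationEngineChaosClosesEulerEnergyDistanceA
import Literature.MathematicalPhysics.KineticTheory.HardSphereCrossSection
import Literature.Analysis.FluidPDE.SphereMeasureSymmetry
import HarnessLib

/-!
# Energy distance on `ℝ³` — helper B: slicing over the sphere, conjunct (i), and the equality case

Helper for the line `Sketch` of the crux `InformationPercolationEngine.ChaosClosesEuler`
(stmt-AtomisticToContinuum-15141), registered stub `stub_energyDistance`.  The HALF-SPACE EMBEDDING
`f(v,(ω,t)) = 1{⟪v,ω⟫ ≤ t} - 1{0 ≤ t}` of `ℝ³` into `L²(S² × ℝ, σ ⊗ dt)` (`sliceFn`) realises the square root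
of the Euclidean distance as a Hilbert distance:

* `(1{a ≤ t} - 1{b ≤ t})² = 1_{[min a b, max a b)}(t)` and `∫ (1{a ≤ t} - 1{b ≤ t})² dt = |a - b|`
  (`sq_indicator_sub_indicator`, `integral_sq_indicator_sub_indicator`);
* `∫_{S²} |⟪u,ω⟫| dσ(ω) = 2π‖u‖` (`integral_abs_inner_sphere`, from the tree's hard-sphere cross-section
  `∫ (u·ω)₊ dω = π‖u‖` and the antipodal symmetry of `σ`);
* hence `∫ (f(v,y) - f(w,y))² d(σ⊗dt)(y) = 2π‖v - w‖` (`integral_sq_sliceFn_sub`), `f` is bounded, jointly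
  measurable and square integrable under `μ ⊗ (σ ⊗ dt)` for every finite `μ` with a first moment
  (`integrable_sq_sliceFn`), and `∫ f(v,(ω,t)) dμ(v) = μ{⟪v,ω⟫ ≤ t} - |μ| 1{0 ≤ t}` (`integral_sliceFn`);
* CONJUNCT (i) of the stub (`energyDistance_nonneg`): by the energy identity of helper A,
  `2π ℰ(μ,ν) = 2 ∫_{S²×ℝ} (F_μ - F_ν)² ≥ 0`;
* the EQUALITY CASE (`measure_eq_of_energyDistance_le_zero`): `ℰ(μ,ν) ≤ 0` forces the sliced distribution
  functions `t ↦ μ{⟪v,ω⟫ ≤ t}`, `t ↦ ν{⟪v,ω⟫ ≤ t}` to agree for `σ`-a.e. `ω` and a.e. `t`, hence (right-continuity,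
  helper A) the projections `μ_ω = ν_ω` for a.e. `ω`; since `charFun μ (r•ω) = charFun μ_ω (r)` (`charFun_map_inner`)
  and `charFun` is continuous while `σ` charges every open subset of `S²`, the characteristic functions agree
  everywhere and `μ = ν` (`Measure.ext_of_charFun`, Cramér–Wold).

References: H. Cramér, H. Wold, *Some theorems on distribution functions*, J. London Math. Soc. 11 (1936); G. J. Székely, M. L. Rizzo, *Energy statistics*, J. Statist. Plann. Inference 143 (2013), Prop. 1–2.
-/

noncomputable section

namespace Summit.AtomisticToContinuum.HydrodynamicLimit.Theorems.ChaosClosesEulerEnergyDistance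

open scoped BigOperators Topology Classical MeasureTheory ENNReal InnerProductSpace
open Filter Set MeasureTheory
open Literature.MathematicalPhysics.KineticTheory
open Literature.Analysis.FluidPDE

/-! ## One dimension: `|a - b| = ∫ (1{a ≤ t} - 1{b ≤ t})² dt` -/

/-- `(1{a ≤ t} - 1{b ≤ t})² = 1_{[min a b, max a b)}(t)`. [folklore] -/
theorem sq_indicator_sub_indicator (a b t : ℝ) :
    ((if a ≤ t then (1 : ℝ) else 0) - (if b ≤ t then (1 : ℝ) else 0)) ^ 2 =
      Set.indicator (Set.Ico (min a b) (max a b)) 1 t := by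
  simp only [Set.indicator_apply, Set.mem_Ico, Pi.one_apply]
  by_cases ha : a ≤ t <;> by_cases hb : b ≤ t
  · have h : ¬(min a b ≤ t ∧ t < max a b) := fun ⟨_, h⟩ => (lt_irrefl t) (h.trans_le (max_le ha hb))
    rw [if_pos ha, if_pos hb, if_neg h]; norm_num
  · have h : min a b ≤ t ∧ t < max a b :=
      ⟨(min_le_left a b).trans ha, lt_of_lt_of_le (lt_of_not_ge hb) (le_max_right a b)⟩
    rw [if_pos ha, if_neg hb, if_pos h]; norm_num
  · have h : min a b ≤ t ∧ t < max a b :=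
      ⟨(min_le_right a b).trans hb, lt_of_lt_of_le (lt_of_not_ge ha) (le_max_left a b)⟩
    rw [if_neg ha, if_pos hb, if_pos h]; norm_num
  · have h : ¬(min a b ≤ t ∧ t < max a b) := by
      rintro ⟨h, -⟩
      rcases le_total a b with hab | hab
      · rw [min_eq_left hab] at h; exact ha h
      · rw [min_eq_right hab] at h; exact hb h
    rw [if_neg ha, if_neg hb, if_neg h]; norm_num

/-- `∫ (1{a ≤ t} - 1{b ≤ t})² dt = |a - b|` (Lebesgue measure on `ℝ`). [folklore] -/
theorem integral_sq_indicator_sub_indicator (a b : ℝ) :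
    ∫ t, ((if a ≤ t then (1 : ℝ) else 0) - (if b ≤ t then (1 : ℝ) else 0)) ^ 2 = |a - b| := by
  simp_rw [sq_indicator_sub_indicator]
  rw [integral_indicator_one measurableSet_Ico, Real.volume_real_Ico_of_le min_le_max]
  rcases le_total a b with h | h
  · rw [max_eq_right h, min_eq_left h, abs_sub_comm, abs_of_nonneg (sub_nonneg.2 h)]
  · rw [max_eq_left h, min_eq_right h, abs_of_nonneg (sub_nonneg.2 h)]

/-- The one-dimensional square `(1{a ≤ t} - 1{b ≤ t})²` is integrable in `t`. [folklore] -/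
theorem integrable_sq_indicator_sub_indicator (a b : ℝ) :
    Integrable (fun t : ℝ => ((if a ≤ t then (1 : ℝ) else 0) - (if b ≤ t then (1 : ℝ) else 0)) ^ 2) := by
  simp_rw [sq_indicator_sub_indicator]
  exact (integrable_indicator_iff measurableSet_Ico).2
    ((integrableOn_const_iff (C := (1 : ℝ))).2 (Or.inr (by rw [Real.volume_Ico]; exact ENNReal.ofReal_lt_top)))

/-! ## The sphere: `∫ |⟪u,ω⟫| dσ = 2π‖u‖` -/

/-- `∫_{S²} |⟪u,ω⟫| dσ(ω) = 2π ‖u‖`: the positive and negative parts each contribute the hard-sphere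
cross-section `π‖u‖`. [folklore] -/
theorem integral_abs_inner_sphere (u : V3) :
    ∫ ω : Metric.sphere (0 : V3) 1, |⟪u, (ω : V3)⟫_ℝ| ∂sphereMeasure = 2 * Real.pi * ‖u‖ := by
  have hpos : ∫ ω : Metric.sphere (0 : V3) 1, max ⟪u, (ω : V3)⟫_ℝ 0 ∂sphereMeasure = Real.pi * ‖u‖ :=
    lorentzLossRate_eq_pi_mul_norm u
  have hneg : ∫ ω : Metric.sphere (0 : V3) 1, max (-⟪u, (ω : V3)⟫_ℝ) 0 ∂sphereMeasure = Real.pi * ‖u‖ := by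
    rw [← integral_posPart_inner_sphere_eq u]; exact hpos
  have habs : ∀ x : ℝ, |x| = max x 0 + max (-x) 0 := fun x => by
    rcases le_total 0 x with h | h
    · rw [abs_of_nonneg h, max_eq_left h, max_eq_right (by linarith), add_zero]
    · rw [abs_of_nonpos h, max_eq_right h, max_eq_left (by linarith), zero_add]
  simp_rw [habs]
  have hc : Continuous fun ω : Metric.sphere (0 : V3) 1 => ⟪u, (ω : V3)⟫_ℝ :=
    continuous_const.inner continuous_subtype_val
  have hb : ∀ ω : Metric.sphere (0 : V3) 1, |⟪u, (ω : V3)⟫_ℝ| ≤ ‖u‖ := fun ω => by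
    have h := abs_real_inner_le_norm u (ω : V3)
    rwa [norm_eq_of_mem_sphere ω, mul_one] at h
  have i1 : Integrable (fun ω : Metric.sphere (0 : V3) 1 => max ⟪u, (ω : V3)⟫_ℝ 0) sphereMeasure :=
    integrable_of_measurable_abs_le (hc.max continuous_const).measurable (B := ‖u‖) fun ω => by
      rw [abs_of_nonneg (le_max_right _ _)]
      exact max_le ((le_abs_self _).trans (hb ω)) (norm_nonneg _)
  have i2 : Integrable (fun ω : Metric.sphere (0 : V3) 1 => max (-⟪u, (ω : V3)⟫_ℝ) 0) sphereMeasure :=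
    integrable_of_measurable_abs_le (hc.neg.max continuous_const).measurable (B := ‖u‖) fun ω => by
      rw [abs_of_nonneg (le_max_right _ _)]
      exact max_le ((neg_le_abs _).trans (hb ω)) (norm_nonneg _)
  rw [integral_add i1 i2, hpos, hneg]
  ring

/-! ## The half-space embedding `f(v,(ω,t)) = 1{⟪v,ω⟫ ≤ t} - 1{0 ≤ t}` -/

/-- The half-space embedding `f(v,(ω,t)) = 1{⟪v,ω⟫ ≤ t} - 1{0 ≤ t}` of `ℝ³` into functions on `S² × ℝ`
(centred at the origin so that `f(v,·)` is square integrable, `∫ f(v,·)² = 2π‖v‖`). [folklore] -/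
def sliceFn (p : V3 × (Metric.sphere (0 : V3) 1 × ℝ)) : ℝ :=
  (if ⟪p.1, (p.2.1 : V3)⟫_ℝ ≤ p.2.2 then 1 else 0) - (if (0 : ℝ) ≤ p.2.2 then 1 else 0)

/-- Pointwise formula for `sliceFn`. [folklore] -/
theorem sliceFn_apply (v : V3) (ω : Metric.sphere (0 : V3) 1) (t : ℝ) :
    sliceFn (v, (ω, t)) = (if ⟪v, (ω : V3)⟫_ℝ ≤ t then (1 : ℝ) else 0) - (if (0 : ℝ) ≤ t then (1 : ℝ) else 0) :=
  rfl

/-- Differences of slices are differences of half-line indicators. [folklore] -/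
theorem sliceFn_sub_sliceFn (v w : V3) (ω : Metric.sphere (0 : V3) 1) (t : ℝ) :
    sliceFn (v, (ω, t)) - sliceFn (w, (ω, t)) =
      (if ⟪v, (ω : V3)⟫_ℝ ≤ t then (1 : ℝ) else 0) - (if ⟪w, (ω : V3)⟫_ℝ ≤ t then (1 : ℝ) else 0) := by
  simp only [sliceFn_apply]; ring

/-- The origin is mapped to zero. [folklore] -/
theorem sliceFn_zero (y : Metric.sphere (0 : V3) 1 × ℝ) : sliceFn (0, y) = 0 := by
  obtain ⟨ω, t⟩ := y
  simp only [sliceFn_apply, inner_zero_left, sub_self]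

/-- `sliceFn` is jointly measurable. [folklore] -/
theorem measurable_sliceFn : Measurable sliceFn := by
  have h1 : Measurable fun p : V3 × (Metric.sphere (0 : V3) 1 × ℝ) => ⟪p.1, (p.2.1 : V3)⟫_ℝ :=
    (continuous_fst.inner (continuous_subtype_val.comp (continuous_fst.comp continuous_snd))).measurable
  have h2 : Measurable fun p : V3 × (Metric.sphere (0 : V3) 1 × ℝ) => p.2.2 :=
    measurable_snd.comp measurable_snd
  refine Measurable.sub ?_ ?_
  · exact Measurable.ite (measurableSet_le h1 h2) measurable_const measurable_const
  · exact Measurable.ite (measurableSet_le measurable_const h2) measurable_const measurable_const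

/-- `|sliceFn| ≤ 1`. [folklore] -/
theorem abs_sliceFn_le_one (p : V3 × (Metric.sphere (0 : V3) 1 × ℝ)) : |sliceFn p| ≤ 1 := by
  obtain ⟨v, ω, t⟩ := p
  rw [sliceFn_apply]
  split_ifs <;> norm_num

/-- The squared slice difference `(f(v,·) - f(w,·))²` is integrable on `S² × ℝ`. [folklore] -/
theorem integrable_sq_sliceFn_sub (v w : V3) :
    Integrable (fun y : Metric.sphere (0 : V3) 1 × ℝ => (sliceFn (v, y) - sliceFn (w, y)) ^ 2)
      ((sphereMeasure : Measure (Metric.sphere (0 : V3) 1)).prod volume) := by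
  have hmeas : Measurable fun y : Metric.sphere (0 : V3) 1 × ℝ => (sliceFn (v, y) - sliceFn (w, y)) ^ 2 :=
    ((measurable_sliceFn.comp (measurable_const.prodMk measurable_id)).sub
      (measurable_sliceFn.comp (measurable_const.prodMk measurable_id))).pow_const 2
  refine (integrable_prod_iff hmeas.aestronglyMeasurable).2 ⟨Eventually.of_forall fun ω => ?_, ?_⟩
  · simp only [sliceFn_sub_sliceFn]
    exact integrable_sq_indicator_sub_indicator _ _
  · have h : ∀ ω : Metric.sphere (0 : V3) 1,
        ∫ t, ‖(sliceFn (v, (ω, t)) - sliceFn (w, (ω, t))) ^ 2‖ = |⟪v - w, (ω : V3)⟫_ℝ| := by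
      intro ω
      simp only [sliceFn_sub_sliceFn, Real.norm_eq_abs, abs_pow, sq_abs]
      rw [integral_sq_indicator_sub_indicator, inner_sub_left]
    simp_rw [h]
    refine integrable_of_measurable_abs_le (continuous_const.inner continuous_subtype_val).measurable.abs
      (B := ‖v - w‖) fun ω => ?_
    rw [abs_abs]
    have h' := abs_real_inner_le_norm (v - w) (ω : V3)
    rwa [norm_eq_of_mem_sphere ω, mul_one] at h'

/-- **Slicing identity**: `∫_{S²×ℝ} (f(v,y) - f(w,y))² d(σ ⊗ dt)(y) = 2π ‖v - w‖`. [folklore] -/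
theorem integral_sq_sliceFn_sub (v w : V3) :
    ∫ y, (sliceFn (v, y) - sliceFn (w, y)) ^ 2 ∂((sphereMeasure : Measure (Metric.sphere (0 : V3) 1)).prod volume) =
      2 * Real.pi * ‖v - w‖ := by
  rw [integral_prod _ (integrable_sq_sliceFn_sub v w)]
  simp only [sliceFn_sub_sliceFn, integral_sq_indicator_sub_indicator]
  simp_rw [← inner_sub_left]
  exact integral_abs_inner_sphere (v - w)

/-- **Square integrability of the embedding**: `f²` is integrable under `μ ⊗ (σ ⊗ dt)` for every finite measure
`μ` on `ℝ³` with a first moment (`∫ f(v,·)² = 2π‖v‖`). [folklore] -/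
theorem integrable_sq_sliceFn (μ : Measure V3) [IsFiniteMeasure μ] (h1 : Integrable (fun v : V3 => ‖v‖) μ) :
    Integrable (fun p => sliceFn p ^ 2)
      (μ.prod ((sphereMeasure : Measure (Metric.sphere (0 : V3) 1)).prod volume)) := by
  refine (integrable_prod_iff (measurable_sliceFn.pow_const 2).aestronglyMeasurable).2
    ⟨Eventually.of_forall fun v => ?_, ?_⟩
  · refine (integrable_sq_sliceFn_sub v 0).congr (Eventually.of_forall fun y => ?_)
    simp only [sliceFn_zero, sub_zero]
  · have h : ∀ v : V3, ∫ y, ‖sliceFn (v, y) ^ 2‖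
        ∂((sphereMeasure : Measure (Metric.sphere (0 : V3) 1)).prod volume) = 2 * Real.pi * ‖v‖ := by
      intro v
      have e : (fun y : Metric.sphere (0 : V3) 1 × ℝ => ‖sliceFn (v, y) ^ 2‖) =
          fun y => (sliceFn (v, y) - sliceFn (0, y)) ^ 2 := by
        funext y; rw [sliceFn_zero, sub_zero, Real.norm_eq_abs, abs_pow, sq_abs]
      rw [e, integral_sq_sliceFn_sub, sub_zero]
    simp_rw [h]
    exact h1.const_mul (2 * Real.pi)

/-- **The sliced distribution function**: `∫ f(v,(ω,t)) dμ(v) = μ{⟪v,ω⟫ ≤ t} - |μ| 1{0 ≤ t}`. [folklore] -/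
theorem integral_sliceFn (μ : Measure V3) [IsFiniteMeasure μ] (ω : Metric.sphere (0 : V3) 1) (t : ℝ) :
    ∫ v, sliceFn (v, (ω, t)) ∂μ =
      μ.real {v : V3 | ⟪v, (ω : V3)⟫_ℝ ≤ t} - μ.real univ * (if (0 : ℝ) ≤ t then (1 : ℝ) else 0) := by
  have hs : MeasurableSet {v : V3 | ⟪v, (ω : V3)⟫_ℝ ≤ t} :=
    measurableSet_le (continuous_id.inner continuous_const).measurable measurable_const
  have e1 : (fun v : V3 => (if ⟪v, (ω : V3)⟫_ℝ ≤ t then (1 : ℝ) else 0)) =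
      Set.indicator {v : V3 | ⟪v, (ω : V3)⟫_ℝ ≤ t} 1 := by
    funext v; simp only [Set.indicator_apply, mem_setOf_eq, Pi.one_apply]
  have i1 : Integrable (fun v : V3 => (if ⟪v, (ω : V3)⟫_ℝ ≤ t then (1 : ℝ) else 0)) μ := by
    rw [e1]; exact (integrable_const 1).indicator hs
  simp only [sliceFn_apply]
  rw [integral_sub i1 (integrable_const _), e1, integral_indicator_one hs, integral_const, smul_eq_mul]

/-! ## Conjunct (i): the Euclidean distance is conditionally negative definite -/

/-- **Energy distance is nonnegative** (Székely): for finite measures `μ`, `ν` on `ℝ³` of equal mass with first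
moments, `∫∫‖v-w‖ dμ dμ + ∫∫‖v-w‖ dν dν ≤ 2 ∫∫‖v-w‖ dν dμ` — the energy identity of helper A for the half-space
embedding, whose kernel is `2π‖v - w‖`. [cite: SzekelyRizzo2013, Prop. 2] -/
theorem energyDistance_nonneg (μ ν : Measure V3) [IsFiniteMeasure μ] [IsFiniteMeasure ν]
    (h1μ : Integrable (fun v : V3 => ‖v‖) μ) (h1ν : Integrable (fun v : V3 => ‖v‖) ν) (hm : μ univ = ν univ) :
    (∫ v, ∫ w, ‖v - w‖ ∂μ ∂μ) + (∫ v, ∫ w, ‖v - w‖ ∂ν ∂ν) ≤ 2 * ∫ v, ∫ w, ‖v - w‖ ∂ν ∂μ := by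
  obtain ⟨-, hid⟩ := energy_identity measurable_sliceFn abs_sliceFn_le_one μ ν
    ((sphereMeasure : Measure (Metric.sphere (0 : V3) 1)).prod volume)
    (integrable_sq_sliceFn μ h1μ) (integrable_sq_sliceFn ν h1ν) hm
  simp only [integral_sq_sliceFn_sub, integral_const_mul] at hid
  have hnn : 0 ≤ ∫ y, (∫ a, sliceFn (a, y) ∂μ - ∫ a, sliceFn (a, y) ∂ν) ^ 2
      ∂((sphereMeasure : Measure (Metric.sphere (0 : V3) 1)).prod volume) := integral_nonneg fun y => sq_nonneg _
  have key : Real.pi * 0 ≤ Real.pi * (2 * (∫ v, ∫ w, ‖v - w‖ ∂ν ∂μ) - (∫ v, ∫ w, ‖v - w‖ ∂μ ∂μ)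
      - (∫ v, ∫ w, ‖v - w‖ ∂ν ∂ν)) := by linarith
  have := le_of_mul_le_mul_left key Real.pi_pos
  linarith

/-! ## The equality case (Cramér–Wold through the characteristic function) -/

/-- **Characteristic function along a ray = characteristic function of the projection**:
`charFun (μ ∘ ⟪·,ω⟫⁻¹) r = charFun μ (r • ω)`. [folklore] -/
theorem charFun_map_inner (μ : Measure V3) (ω : V3) (r : ℝ) :
    charFun (μ.map fun v : V3 => ⟪v, ω⟫_ℝ) r = charFun μ (r • ω) := by
  rw [charFun_apply, charFun_apply, integral_map (by fun_prop) (by fun_prop)]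
  congr 1
  funext v
  simp only [RCLike.inner_apply, conj_trivial, real_inner_smul_right, Complex.ofReal_mul]

/-- The surface measure of the unit sphere charges every nonempty open set. [folklore] -/
theorem isOpenPosMeasure_sphereMeasure :
    (sphereMeasure : Measure (Metric.sphere (0 : V3) 1)).IsOpenPosMeasure :=
  show ((volume : Measure V3).toSphere).IsOpenPosMeasure from inferInstance

/-- **Equality case of the energy distance** (Székely–Rizzo, Prop. 2): finite measures on `ℝ³` of equal mass with
first moments and energy distance `≤ 0` coincide. [cite: SzekelyRizzo2013, Prop. 2] -/
theorem measure_eq_of_energyDistance_le_zero (μ ν : Measure V3) [IsFiniteMeasure μ] [IsFiniteMeasure ν]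
    (h1μ : Integrable (fun v : V3 => ‖v‖) μ) (h1ν : Integrable (fun v : V3 => ‖v‖) ν) (hm : μ univ = ν univ)
    (hE : 2 * (∫ v, ∫ w, ‖v - w‖ ∂ν ∂μ) - (∫ v, ∫ w, ‖v - w‖ ∂μ ∂μ) - (∫ v, ∫ w, ‖v - w‖ ∂ν ∂ν) ≤ 0) :
    μ = ν := by
  have hmr : μ.real univ = ν.real univ := by simp only [measureReal_def, hm]
  -- Step 1: the sliced distribution functions agree a.e. on `S² × ℝ`
  have hae : (fun y => ∫ a, sliceFn (a, y) ∂μ)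
      =ᵐ[(sphereMeasure : Measure (Metric.sphere (0 : V3) 1)).prod volume] fun y => ∫ a, sliceFn (a, y) ∂ν := by
    refine ae_eq_of_energy_le_zero measurable_sliceFn abs_sliceFn_le_one μ ν _
      (integrable_sq_sliceFn μ h1μ) (integrable_sq_sliceFn ν h1ν) hm ?_
    simp only [integral_sq_sliceFn_sub, integral_const_mul]
    nlinarith [Real.pi_pos]
  -- Step 2: for a.e. direction and a.e. level, the half-space masses agree
  have hae2 : ∀ᵐ ω : Metric.sphere (0 : V3) 1 ∂sphereMeasure, ∀ᵐ t : ℝ ∂volume,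
      μ {v : V3 | ⟪v, (ω : V3)⟫_ℝ ≤ t} = ν {v : V3 | ⟪v, (ω : V3)⟫_ℝ ≤ t} := by
    filter_upwards [Measure.ae_ae_of_ae_prod hae] with ω hω
    filter_upwards [hω] with t ht
    have ht' : ∫ a, sliceFn (a, (ω, t)) ∂μ = ∫ a, sliceFn (a, (ω, t)) ∂ν := ht
    rw [integral_sliceFn, integral_sliceFn, hmr, sub_left_inj] at ht'
    exact (ENNReal.toReal_eq_toReal_iff' (measure_ne_top μ _) (measure_ne_top ν _)).1 ht'
  -- Step 3: for such directions the projections agree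
  have hmap : ∀ᵐ ω : Metric.sphere (0 : V3) 1 ∂sphereMeasure,
      μ.map (fun v : V3 => ⟪v, (ω : V3)⟫_ℝ) = ν.map (fun v : V3 => ⟪v, (ω : V3)⟫_ℝ) := by
    filter_upwards [hae2] with ω hω
    have hmeas : Measurable fun v : V3 => ⟪v, (ω : V3)⟫_ℝ := (continuous_id.inner continuous_const).measurable
    refine measure_eq_of_ae_measure_Iic_eq _ _ ?_
    filter_upwards [hω] with t ht
    rw [Measure.map_apply hmeas measurableSet_Iic, Measure.map_apply hmeas measurableSet_Iic]
    exact ht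
  -- Step 4: the characteristic functions agree on almost every ray ...
  have hcf : ∀ᵐ ω : Metric.sphere (0 : V3) 1 ∂sphereMeasure, ∀ r : ℝ,
      charFun μ (r • (ω : V3)) = charFun ν (r • (ω : V3)) := by
    filter_upwards [hmap] with ω hω
    intro r
    rw [← charFun_map_inner μ, ← charFun_map_inner ν, hω]
  -- Step 5: ... hence on every ray (continuity in the direction, full support of `σ`)
  haveI := isOpenPosMeasure_sphereMeasure
  have hall : ∀ (ω : Metric.sphere (0 : V3) 1) (r : ℝ), charFun μ (r • (ω : V3)) = charFun ν (r • (ω : V3)) := by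
    intro ω r
    have hc : ∀ (ρ : Measure V3) [IsFiniteMeasure ρ],
        Continuous fun ω : Metric.sphere (0 : V3) 1 => charFun ρ (r • (ω : V3)) :=
      fun ρ _ => continuous_charFun.comp (by fun_prop)
    have heq : (fun ω : Metric.sphere (0 : V3) 1 => charFun μ (r • (ω : V3)))
        =ᵐ[(sphereMeasure : Measure (Metric.sphere (0 : V3) 1))]
        fun ω : Metric.sphere (0 : V3) 1 => charFun ν (r • (ω : V3)) := by
      filter_upwards [hcf] with ω hω using hω r
    exact congrFun (Measure.eq_of_ae_eq heq (hc μ) (hc ν)) ω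
  -- Step 6: conclude with the injectivity of the characteristic function
  apply Measure.ext_of_charFun
  funext ξ
  by_cases hξ : ξ = 0
  · subst hξ
    rw [charFun_zero, charFun_zero, hmr]
  · have hn : ‖ξ‖ ≠ 0 := norm_ne_zero_iff.2 hξ
    have hω : ‖ξ‖⁻¹ • ξ ∈ Metric.sphere (0 : V3) 1 := by
      rw [mem_sphere_zero_iff_norm, norm_smul, norm_inv, norm_norm, inv_mul_cancel₀ hn]
    have hξ' : ξ = ‖ξ‖ • ((⟨‖ξ‖⁻¹ • ξ, hω⟩ : Metric.sphere (0 : V3) 1) : V3) := by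
      simp only [smul_smul, mul_inv_cancel₀ hn, one_smul]
    rw [hξ']
    exact hall _ _

/-! ## Registered sub-goal -/

/-- **Registered sub-goal `stub_energyDistanceB` (helper B of `stub_energyDistance`): conjunct (i) of the stub** —
the Euclidean distance on `ℝ³` is conditionally negative definite on finite measures of equal mass with first
moments: `∫∫‖v-w‖ dμ dμ + ∫∫‖v-w‖ dν dν ≤ 2∫∫‖v-w‖ dν dμ`. [cite: SzekelyRizzo2013, Prop. 2] -/
theorem stub_energyDistanceB : ∀ μ ν : Measure V3, IsFiniteMeasure μ → IsFiniteMeasure ν → Integrable (fun v : V3 => ‖v‖) μ → Integrable (fun v : V3 => ‖v‖) ν → μ Set.univ = ν Set.univ → (∫ v, ∫ w, ‖v - w‖ ∂μ ∂μ) + (∫ v, ∫ w, ‖v - w‖ ∂ν ∂ν) ≤ 2 * ∫ v, ∫ w, ‖v - w‖ ∂ν ∂μ :=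
  fun μ ν _ _ h1μ h1ν hm => energyDistance_nonneg μ ν h1μ h1ν hm

end Summit.AtomisticToContinuum.HydrodynamicLimit.Theorems.ChaosClosesEulerEnergyDistance

end
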